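import Literature.Analysis.SpecialFunctions.OblateSpheroidalSphereBasis
import Literature.Analysis.OperatorTheory.PerturbedResolventFamily
import HarnessLib

/-!
# The resolvent family of the oblate spheroidal operators `P(ν) = -Δ_{S²} - ν² cos²θ` and their
# canonical spectral projections

Dafermos–Rodnianski–Shlapentokh-Rothman, arXiv:1402.7034, §5.2.1: for each real `ν` the operator
`P(ν)` on `𝓗 = L²(sin θ dθ dφ)` has the complete orthonormal eigenbasis `Ψ_q(ν)` with eigenvalues
`λ_q(ν)` (`oblateSphereBasis`, `oblateSphereEig`, chosen for every `ν`). To treat frequency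
ranges defined through `λ` *measurably in `ν`* (the trapping cells of §13.1.3, Def. 13.1.2) one
needs objects that do not depend on the choice of eigenbasis: here, for `|ν| ≤ N`,

* `oblateResolvent N ν = (P(ν) + c_N)⁻¹`, `c_N = 2N² + 1`, defined WITHOUT the eigenbasis
  (as the perturbed resolvent `pertResolvent` of the diagonal `(-Δ + c_N)⁻¹` in the FIXED
  spherical-harmonic tensor basis `Y_{m,k}` by the bounded perturbation `-ν² cos²θ`);
* `oblateResolvent_basis`: `Ψ_q(ν)` is an eigenbasis of it, eigenvalues `(λ_q(ν) + c_N)⁻¹`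
  (from the weak eigen-equation `oblateSphere_weak`), `oblateResolvent_eq_diag`;
* `oblateSpecProj ν J = Σ_{λ_q(ν) ∈ J} ⟨Ψ_q(ν), ·⟩ Ψ_q(ν)` and **`oblateSpecProj_eq_of_coeff`**:
  any other Hilbert basis satisfying the weak eigen-equations gives the same projection;
* **`norm_oblateResolvent_sub_le`**: `‖(P(ν)+c)⁻¹ - (P(ν')+c)⁻¹‖ ≤ 4 |ν² - ν'²|`
  (second resolvent identity), whence continuity in `ν` (`continuousOn_oblateResolvent`).

## References

* M. Dafermos, I. Rodnianski, Y. Shlapentokh-Rothman, arXiv:1402.7034, §5.2.1, §13.1.3.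
  [DafermosRodnianskiShlapentokhrothman2014]
* M. Reed, B. Simon, *Methods of Modern Mathematical Physics IV* (1978), Thm. XIII.64.
  [ReedSimonIV1978]
-/

noncomputable section

open Filter Topology Set MeasureTheory ContinuousLinearMap
open scoped InnerProductSpace ComplexConjugate ENNReal

namespace Literature.Analysis.SpecialFunctions

open Literature.Analysis.OperatorTheory Literature.Analysis.FunctionSpaces

variable {T : ℝ} [hT : Fact (0 < T)]

/-! ### The fixed basis and the unperturbed resolvent -/

variable (T) in
/-- The spherical-harmonic tensor basis `Y_{m,k}` as a Hilbert basis (canonical: the fibred tensor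
basis of the associated-Legendre bases with the Fourier basis). [folklore] -/
def sphHarmBasis : HilbertBasis (Σ _ : ℤ, ℕ) ℂ (Lp ℂ 2 (sphereMeasure T)) :=
  fibredTensorBasis (fun m : ℤ ↦ assocLegBasis m.natAbs) (fourierBasis (T := T))

/-- `Y_{m,k}` as the basis vectors. [folklore] -/
theorem sphHarmBasis_apply (p : Σ _ : ℤ, ℕ) : sphHarmBasis T p = sphHarmTensor T p.1 p.2 := by
  rw [sphHarmBasis, fibredTensorBasis_apply, coe_fourierBasis, sphHarmTensor]

/-- The levels `Λ_{|m|,k} = (k+|m|)(k+|m|+1)` of `-Δ_{S²}` on `Y_{m,k}`. [folklore] -/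
def sphLevel (p : Σ _ : ℤ, ℕ) : ℝ := assocLegLevel p.1.natAbs p.2

/-- The levels are nonnegative. [folklore] -/
theorem sphLevel_nonneg (p : Σ _ : ℤ, ℕ) : 0 ≤ sphLevel p :=
  le_trans (by positivity) (assocLegLevel_ge p.1.natAbs p.2)

/-- The shift `c_N = 2N² + 1`. [folklore] -/
def oblateShift (N : ℝ) : ℝ := 2 * N ^ 2 + 1

/-- `0 < c_N`. [folklore] -/
theorem oblateShift_pos (N : ℝ) : 0 < oblateShift N := by unfold oblateShift; positivity

/-- `1 ≤ c_N`. [folklore] -/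
theorem one_le_oblateShift (N : ℝ) : 1 ≤ oblateShift N := by unfold oblateShift; nlinarith

/-- The diagonal entries `(Λ_p + c_N)⁻¹` of the unperturbed resolvent. [folklore] -/
def oblateR₀Coef (N : ℝ) (p : Σ _ : ℤ, ℕ) : ℂ := (((sphLevel p + oblateShift N)⁻¹ : ℝ) : ℂ)

/-- `0 < Λ + c_N`. [folklore] -/
theorem sphLevel_add_oblateShift_pos (N : ℝ) (p : Σ _ : ℤ, ℕ) : 0 < sphLevel p + oblateShift N :=
  add_pos_of_nonneg_of_pos (sphLevel_nonneg p) (oblateShift_pos N)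

/-- `|(Λ + c_N)⁻¹| ≤ c_N⁻¹`. [folklore] -/
theorem norm_oblateR₀Coef_le (N : ℝ) (p : Σ _ : ℤ, ℕ) : ‖oblateR₀Coef N p‖ ≤ (oblateShift N)⁻¹ := by
  rw [oblateR₀Coef, Complex.norm_real, Real.norm_eq_abs,
    abs_of_pos (inv_pos.2 (sphLevel_add_oblateShift_pos N p))]
  exact inv_anti₀ (oblateShift_pos N) (le_add_of_nonneg_left (sphLevel_nonneg p))

variable (T) in
/-- **The unperturbed resolvent `(-Δ_{S²} + c_N)⁻¹ = diag_Y((Λ + c_N)⁻¹)`.** [folklore] -/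
def oblateR₀ (N : ℝ) : Lp ℂ 2 (sphereMeasure T) →L[ℂ] Lp ℂ 2 (sphereMeasure T) :=
  basisDiag (sphHarmBasis T) (oblateR₀Coef N) (oblateShift N)⁻¹ (norm_oblateR₀Coef_le N)

/-- `‖R₀‖ ≤ c_N⁻¹`. [folklore] -/
theorem norm_oblateR₀_le (N : ℝ) : ‖oblateR₀ T N‖ ≤ (oblateShift N)⁻¹ :=
  norm_diag_le (inv_pos.2 (oblateShift_pos N)).le (norm_oblateR₀Coef_le N)

/-! ### The perturbation `-ν² cos²θ` -/

/-- `‖x² F‖ ≤ ‖F‖`. [folklore] -/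
theorem norm_mulSqFst_apply_le (F : Lp ℂ 2 (sphereMeasure T)) : ‖mulSqFst T F‖ ≤ ‖F‖ := by
  refine Lp.norm_le_norm_of_ae_le ?_
  filter_upwards [coeFn_mulSqFst F, ae_fst_mem_Icc (T := T)] with z hz hmem
  rw [hz, norm_mul, Complex.norm_real, Real.norm_eq_abs, abs_of_nonneg (sq_nonneg _)]
  have h1 : z.1 ^ 2 ≤ 1 := by
    have := abs_le.2 ⟨by linarith [hmem.1], hmem.2⟩
    nlinarith [abs_nonneg z.1, sq_abs z.1]
  exact (mul_le_of_le_one_left (norm_nonneg _) h1)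

/-- `‖x² ·‖ ≤ 1`. [folklore] -/
theorem norm_mulSqFst_le : ‖mulSqFst T‖ ≤ 1 :=
  ContinuousLinearMap.opNorm_le_bound _ zero_le_one fun F ↦ by
    rw [one_mul]; exact norm_mulSqFst_apply_le F

variable (T) in
/-- **The perturbation `B_ν = -ν² cos²θ`** (multiplication by `-ν² x²`). [folklore] -/
def oblatePert (ν : ℝ) : Lp ℂ 2 (sphereMeasure T) →L[ℂ] Lp ℂ 2 (sphereMeasure T) :=
  (-((ν ^ 2 : ℝ) : ℂ)) • mulSqFst T

/-- Unfolding. [folklore] -/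
theorem oblatePert_apply (ν : ℝ) (F : Lp ℂ 2 (sphereMeasure T)) :
    oblatePert T ν F = (-((ν ^ 2 : ℝ) : ℂ)) • mulSqFst T F := rfl

/-- `‖B_ν‖ ≤ ν²`. [folklore] -/
theorem norm_oblatePert_le (ν : ℝ) : ‖oblatePert T ν‖ ≤ ν ^ 2 := by
  rw [oblatePert, norm_smul, norm_neg, Complex.norm_real, Real.norm_eq_abs,
    abs_of_nonneg (sq_nonneg ν)]
  exact (mul_le_mul_of_nonneg_left norm_mulSqFst_le (sq_nonneg ν)).trans (mul_one _).le

/-- `B_ν - B_{ν'} = -(ν² - ν'²) x²`. [folklore] -/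
theorem oblatePert_sub (ν ν' : ℝ) : oblatePert T ν - oblatePert T ν' =
    (-(((ν ^ 2 - ν' ^ 2 : ℝ)) : ℂ)) • mulSqFst T := by
  rw [oblatePert, oblatePert, ← sub_smul]
  congr 1
  push_cast
  ring

/-- `‖B_ν - B_{ν'}‖ ≤ |ν² - ν'²|`. [folklore] -/
theorem norm_oblatePert_sub_le (ν ν' : ℝ) :
    ‖oblatePert T ν - oblatePert T ν'‖ ≤ |ν ^ 2 - ν' ^ 2| := by
  rw [oblatePert_sub, norm_smul, norm_neg, Complex.norm_real, Real.norm_eq_abs]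
  exact (mul_le_mul_of_nonneg_left norm_mulSqFst_le (abs_nonneg _)).trans (mul_one _).le

/-- **Smallness `‖R₀ B_ν‖ ≤ 1/2`** for `|ν| ≤ N`. [folklore] -/
theorem norm_oblateR₀_comp_le {N ν : ℝ} (hν : |ν| ≤ N) :
    ‖oblateR₀ T N ∘L oblatePert T ν‖ ≤ 1 / 2 := by
  have hN : 0 ≤ N := (abs_nonneg ν).trans hν
  have hν2 : ν ^ 2 ≤ N ^ 2 := by
    have := sq_abs ν; nlinarith [abs_nonneg ν]
  calc ‖oblateR₀ T N ∘L oblatePert T ν‖ ≤ ‖oblateR₀ T N‖ * ‖oblatePert T ν‖ := opNorm_comp_le _ _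
    _ ≤ (oblateShift N)⁻¹ * ν ^ 2 :=
        mul_le_mul (norm_oblateR₀_le N) (norm_oblatePert_le ν) (norm_nonneg _)
          (inv_pos.2 (oblateShift_pos N)).le
    _ ≤ 1 / 2 := by
        rw [oblateShift, inv_mul_le_iff₀ (by positivity : (0 : ℝ) < 2 * N ^ 2 + 1)]
        nlinarith

/-- `‖R₀ B_ν‖ < 1`. [folklore] -/
theorem norm_oblateR₀_comp_lt {N ν : ℝ} (hν : |ν| ≤ N) : ‖oblateR₀ T N ∘L oblatePert T ν‖ < 1 :=
  (norm_oblateR₀_comp_le hν).trans_lt (by norm_num)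

/-! ### The resolvent -/

variable (T) in
/-- **The resolvent `(P(ν) + c_N)⁻¹` of the oblate spheroidal operator**, `|ν| ≤ N`, defined
without reference to the eigenbasis. [cite: DafermosRodnianskiShlapentokhrothman2014, §5.2.1] -/
def oblateResolvent (N ν : ℝ) (hν : |ν| ≤ N) :
    Lp ℂ 2 (sphereMeasure T) →L[ℂ] Lp ℂ 2 (sphereMeasure T) :=
  pertResolvent (sphHarmBasis T) (norm_oblateR₀Coef_le N) (oblatePert T ν)
    (norm_oblateR₀_comp_lt hν)

/-- `‖(P(ν) + c_N)⁻¹‖ ≤ 2`. [folklore] -/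
theorem norm_oblateResolvent_le {N ν : ℝ} (hν : |ν| ≤ N) : ‖oblateResolvent T N ν hν‖ ≤ 2 := by
  have h := norm_pertResolvent_le (e := sphHarmBasis T) (hr := norm_oblateR₀Coef_le N)
    (B := oblatePert T ν) (norm_oblateR₀_comp_lt hν)
  refine h.trans ?_
  have h1 : ‖basisDiag (sphHarmBasis T) (oblateR₀Coef N) (oblateShift N)⁻¹
      (norm_oblateR₀Coef_le N)‖ ≤ 1 :=
    (norm_oblateR₀_le (T := T) N).trans (inv_le_one_of_one_le₀ (one_le_oblateShift N))
  have h2 := norm_oblateR₀_comp_le (T := T) hν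
  have h3 : (1 : ℝ) / 2 ≤ 1 - ‖basisDiag (sphHarmBasis T) (oblateR₀Coef N) (oblateShift N)⁻¹
      (norm_oblateR₀Coef_le N) ∘L oblatePert T ν‖ := by
    change ‖oblateR₀ T N ∘L oblatePert T ν‖ ≤ 1 / 2 at h2
    change (1 : ℝ) / 2 ≤ 1 - ‖oblateR₀ T N ∘L oblatePert T ν‖
    linarith
  calc _ ≤ 1 / (1 / 2 : ℝ) := div_le_div₀ zero_le_one h1 (by norm_num) h3
    _ = 2 := by norm_num

/-- **The shifted eigenvalues are `≥ 1`**: `1 ≤ λ_q(ν) + c_N` for `|ν| ≤ N` (DRSR (33)).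
[cite: DafermosRodnianskiShlapentokhrothman2014, §5.2.1 (33)] -/
theorem one_le_oblateSphereEig_add {N ν : ℝ} (hν : |ν| ≤ N) (q : OblateSphereIndex ν) :
    1 ≤ oblateSphereEig ν q + oblateShift N := by
  have h := le_oblateSphereEig ν q
  have hν2 : ν ^ 2 ≤ N ^ 2 := by
    have := sq_abs ν; nlinarith [abs_nonneg ν]
  have h0 : 0 ≤ |(q.1 : ℝ)| * (|(q.1 : ℝ)| + 1) := by positivity
  have hN := sq_nonneg N
  unfold oblateShift
  linarith

/-- **The coefficient eigen-equations** of `Ψ_q(ν)` for the pair (`R₀`, `B_ν`):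
`Ψ_q + R₀ B_ν Ψ_q = (λ_q + c_N) • R₀ Ψ_q` — the weak eigen-equation `oblateSphere_weak` divided by
`Λ + c_N`. [cite: DafermosRodnianskiShlapentokhrothman2014, §5.2.1 (32)] -/
theorem oblateSphereBasis_coeff (N ν : ℝ) (q : OblateSphereIndex ν) :
    oblateSphereBasis T ν q + oblateR₀ T N (oblatePert T ν (oblateSphereBasis T ν q)) =
      ((oblateSphereEig ν q + oblateShift N : ℝ) : ℂ) • oblateR₀ T N (oblateSphereBasis T ν q) := by
  refine (sphHarmBasis T).ext_inner fun p ↦ ?_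
  rw [inner_add_right, oblateR₀, inner_basis_diag, inner_smul_right, inner_basis_diag,
    oblatePert_apply, inner_smul_right, sphHarmBasis_apply]
  have hw := oblateSphere_weak (T := T) ν q p.1 p.2
  have hpos := sphLevel_add_oblateShift_pos N p
  have hne : ((sphLevel p + oblateShift N : ℝ) : ℂ) ≠ 0 := by exact_mod_cast hpos.ne'
  rw [oblateR₀Coef]
  -- clear the denominator `Λ_p + c_N`
  have key : ((sphLevel p + oblateShift N : ℝ) : ℂ) *
      (⟪sphHarmTensor T p.1 p.2, oblateSphereBasis T ν q⟫_ℂ +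
        (((sphLevel p + oblateShift N)⁻¹ : ℝ) : ℂ) *
          (-((ν ^ 2 : ℝ) : ℂ) *
            ⟪sphHarmTensor T p.1 p.2, mulSqFst T (oblateSphereBasis T ν q)⟫_ℂ)) =
      ((sphLevel p + oblateShift N : ℝ) : ℂ) *
        (((oblateSphereEig ν q + oblateShift N : ℝ) : ℂ) *
          ((((sphLevel p + oblateShift N)⁻¹ : ℝ) : ℂ) *
            ⟪sphHarmTensor T p.1 p.2, oblateSphereBasis T ν q⟫_ℂ)) := by
    have hinv : ((sphLevel p + oblateShift N : ℝ) : ℂ) *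
        (((sphLevel p + oblateShift N)⁻¹ : ℝ) : ℂ) = 1 := by
      rw [Complex.ofReal_inv, mul_inv_cancel₀ hne]
    have hw' : ((sphLevel p : ℝ) : ℂ) * ⟪sphHarmTensor T p.1 p.2, oblateSphereBasis T ν q⟫_ℂ -
        ((ν ^ 2 : ℝ) : ℂ) * ⟪sphHarmTensor T p.1 p.2, mulSqFst T (oblateSphereBasis T ν q)⟫_ℂ =
        (oblateSphereEig ν q : ℂ) * ⟪sphHarmTensor T p.1 p.2, oblateSphereBasis T ν q⟫_ℂ := hw
    push_cast at hinv hw' ⊢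
    linear_combination hw' +
      (-((oblateSphereEig ν q : ℂ) + (oblateShift N : ℂ)) *
          ⟪sphHarmTensor T p.1 p.2, oblateSphereBasis T ν q⟫_ℂ -
        (ν : ℂ) ^ 2 * ⟪sphHarmTensor T p.1 p.2, mulSqFst T (oblateSphereBasis T ν q)⟫_ℂ) * hinv
  exact mul_left_cancel₀ hne key

/-- **`Ψ_q(ν)` is an eigenbasis of the resolvent**: `(P(ν)+c_N)⁻¹ Ψ_q = (λ_q + c_N)⁻¹ Ψ_q`.
[cite: DafermosRodnianskiShlapentokhrothman2014, §5.2.1] -/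
theorem oblateResolvent_basis {N ν : ℝ} (hν : |ν| ≤ N) (q : OblateSphereIndex ν) :
    oblateResolvent T N ν hν (oblateSphereBasis T ν q) =
      (((oblateSphereEig ν q + oblateShift N : ℝ) : ℂ))⁻¹ • oblateSphereBasis T ν q := by
  refine pertResolvent_basis_of_coeff (norm_oblateR₀_comp_lt hν)
    (f := fun q ↦ oblateSphereBasis T ν q)
    (μ := fun q ↦ ((oblateSphereEig ν q + oblateShift N : ℝ) : ℂ))
    (fun q ↦ oblateSphereBasis_coeff N ν q) (fun q ↦ ?_) q
  exact_mod_cast (lt_of_lt_of_le one_pos (one_le_oblateSphereEig_add hν q)).ne'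

/-- Norm form of the lower bound. [folklore] -/
theorem one_le_norm_oblateSphereEig_add {N ν : ℝ} (hν : |ν| ≤ N) (q : OblateSphereIndex ν) :
    (1 : ℝ) ≤ ‖((oblateSphereEig ν q + oblateShift N : ℝ) : ℂ)‖ := by
  rw [Complex.norm_real, Real.norm_eq_abs]
  exact (one_le_oblateSphereEig_add hν q).trans (le_abs_self _)

/-- **Diagonal form**: `(P(ν)+c_N)⁻¹ = diag_{Ψ(ν)}((λ + c_N)⁻¹)`. [folklore] -/
theorem oblateResolvent_eq_diag {N ν : ℝ} (hν : |ν| ≤ N) :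
    oblateResolvent T N ν hν = basisDiag (oblateSphereBasis T ν)
      (fun q ↦ (((oblateSphereEig ν q + oblateShift N : ℝ) : ℂ))⁻¹) 1⁻¹
      (norm_inv_le_of_le one_pos (one_le_norm_oblateSphereEig_add hν)) :=
  pertResolvent_eq_diag (norm_oblateR₀_comp_lt hν) (oblateSphereBasis T ν) one_pos
    (one_le_norm_oblateSphereEig_add hν) (fun q ↦ oblateSphereBasis_coeff N ν q)

/-! ### Spectral projections -/

variable (T) in
/-- **The spectral projection of `P(ν)` onto the eigenvalues in `J`**:
`E_J(ν) F = Σ_{λ_q(ν) ∈ J} ⟨Ψ_q(ν), F⟩ Ψ_q(ν)`.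
[cite: DafermosRodnianskiShlapentokhrothman2014, §13.1.3, Def. 13.1.2] -/
def oblateSpecProj (ν : ℝ) (J : Set ℝ) : Lp ℂ 2 (sphereMeasure T) →L[ℂ] Lp ℂ 2 (sphereMeasure T) :=
  specProj (oblateSphereBasis T ν) (oblateSphereEig ν) J

/-- Relabelling the levels of a spectral projection along a map that is faithful on them.
[folklore] -/
theorem specProj_congr_levels {ι 𝕜 H : Type*} [RCLike 𝕜] [NormedAddCommGroup H]
    [InnerProductSpace 𝕜 H] (e : HilbertBasis ι 𝕜 H) {κ κ' : ι → ℝ} {J J' : Set ℝ}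
    (h : ∀ i, κ i ∈ J ↔ κ' i ∈ J') : (specProj e κ J : H →L[𝕜] H) = specProj e κ' J' := by
  classical
  ext x
  refine e.ext_inner fun i ↦ ?_
  rw [inner_basis_specProj, inner_basis_specProj]
  simp only [h i]

/-- The shifted-inverse relabelling: `λ ∈ J ↔ (λ + c)⁻¹ ∈ {(t + c)⁻¹ : t ∈ J, -c < t}` for
`-c < λ`. [folklore] -/
theorem mem_iff_inv_mem_image {c lam : ℝ} (hl : -c < lam) (J : Set ℝ) :
    lam ∈ J ↔ (lam + c)⁻¹ ∈ (fun t ↦ (t + c)⁻¹) '' (J ∩ {t | -c < t}) := by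
  constructor
  · exact fun h ↦ ⟨lam, ⟨h, hl⟩, rfl⟩
  · rintro ⟨t, ⟨ht, htc⟩, hteq⟩
    have h1 : 0 < t + c := by linarith [show -c < t from htc]
    have h2 : 0 < lam + c := by linarith
    have : t + c = lam + c := inv_injective hteq |> fun h ↦ by exact h
    have : t = lam := by linarith
    rw [← this]; exact ht

/-- **The spectral projections are functions of the resolvent**: in terms of the resolvent
eigenvalues `(λ_q + c_N)⁻¹`. [folklore] -/
theorem oblateSpecProj_eq_inv {N ν : ℝ} (hν : |ν| ≤ N) (J : Set ℝ) :
    oblateSpecProj T ν J = specProj (oblateSphereBasis T ν)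
      (fun q ↦ (oblateSphereEig ν q + oblateShift N)⁻¹)
      ((fun t ↦ (t + oblateShift N)⁻¹) '' (J ∩ {t | -oblateShift N < t})) :=
  specProj_congr_levels _ fun q ↦ mem_iff_inv_mem_image
    (by linarith [one_le_oblateSphereEig_add hν q]) J

/-- **Independence of the eigenbasis.** Any Hilbert basis `f` of `𝓗` satisfying the weak
eigen-equations of `P(ν)` against all `Y_{m,k}` with eigenvalues `μ_j`,
`Λ_{|m|,k} ⟨Y_{m,k}, f_j⟩ - ν² ⟨Y_{m,k}, x² f_j⟩ = μ_j ⟨Y_{m,k}, f_j⟩`, and `-c_N < μ_j`,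
defines the same spectral projections as `Ψ(ν)`: `Σ_{μ_j ∈ J} ⟨f_j, ·⟩ f_j = E_J(ν)`.
[cite: DafermosRodnianskiShlapentokhrothman2014, §5.2.1] -/
theorem oblateSpecProj_eq_of_coeff {N ν : ℝ} (hν : |ν| ≤ N) {ι' : Type*}
    (f : HilbertBasis ι' ℂ (Lp ℂ 2 (sphereMeasure T))) {μ : ι' → ℝ}
    (hμ : ∀ j, 1 ≤ μ j + oblateShift N)
    (hf : ∀ j (m : ℤ) (k : ℕ), (assocLegLevel m.natAbs k : ℂ) * ⟪sphHarmTensor T m k, f j⟫_ℂ -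
      ((ν ^ 2 : ℝ) : ℂ) * ⟪sphHarmTensor T m k, mulSqFst T (f j)⟫_ℂ =
        (μ j : ℂ) * ⟪sphHarmTensor T m k, f j⟫_ℂ) (J : Set ℝ) :
    (specProj f μ J : Lp ℂ 2 (sphereMeasure T) →L[ℂ] _) = oblateSpecProj T ν J := by
  -- coefficient equations for `f`
  have hcoef : ∀ j, f j + oblateR₀ T N (oblatePert T ν (f j)) =
      ((μ j + oblateShift N : ℝ) : ℂ) • oblateR₀ T N (f j) := by
    intro j
    refine (sphHarmBasis T).ext_inner fun p ↦ ?_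
    rw [inner_add_right, oblateR₀, inner_basis_diag, inner_smul_right, inner_basis_diag,
      oblatePert_apply, inner_smul_right, sphHarmBasis_apply, oblateR₀Coef]
    have hpos := sphLevel_add_oblateShift_pos N p
    have hne : ((sphLevel p + oblateShift N : ℝ) : ℂ) ≠ 0 := by exact_mod_cast hpos.ne'
    have hinv : ((sphLevel p + oblateShift N : ℝ) : ℂ) *
        (((sphLevel p + oblateShift N)⁻¹ : ℝ) : ℂ) = 1 := by
      rw [Complex.ofReal_inv, mul_inv_cancel₀ hne]
    have hw' : ((sphLevel p : ℝ) : ℂ) * ⟪sphHarmTensor T p.1 p.2, f j⟫_ℂ -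
        ((ν ^ 2 : ℝ) : ℂ) * ⟪sphHarmTensor T p.1 p.2, mulSqFst T (f j)⟫_ℂ =
        (μ j : ℂ) * ⟪sphHarmTensor T p.1 p.2, f j⟫_ℂ := hf j p.1 p.2
    refine mul_left_cancel₀ hne ?_
    push_cast at hinv hw' ⊢
    linear_combination hw' +
      (-((μ j : ℂ) + (oblateShift N : ℂ)) * ⟪sphHarmTensor T p.1 p.2, f j⟫_ℂ -
        (ν : ℂ) ^ 2 * ⟪sphHarmTensor T p.1 p.2, mulSqFst T (f j)⟫_ℂ) * hinv
  have hμb : ∀ j, (1 : ℝ) ≤ ‖((μ j + oblateShift N : ℝ) : ℂ)‖ := fun j ↦ by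
    rw [Complex.norm_real, Real.norm_eq_abs]; exact (hμ j).trans (le_abs_self _)
  have h := specProj_eq_of_coeff_eigenbasis (norm_oblateR₀_comp_lt (T := T) hν) f
    (oblateSphereBasis T ν) (μ := fun j ↦ μ j + oblateShift N)
    (μ' := fun q ↦ oblateSphereEig ν q + oblateShift N) one_pos hμb
    (one_le_norm_oblateSphereEig_add hν) hcoef (fun q ↦ oblateSphereBasis_coeff N ν q)
    ((fun t ↦ (t + oblateShift N)⁻¹) '' (J ∩ {t | -oblateShift N < t}))
  rw [oblateSpecProj_eq_inv hν, ← h]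
  exact specProj_congr_levels _ fun j ↦ mem_iff_inv_mem_image (by linarith [hμ j]) J

/-! ### Continuity in `ν` -/

/-- **Second-resolvent Lipschitz bound**: `‖(P(ν)+c_N)⁻¹ - (P(ν')+c_N)⁻¹‖ ≤ 4 |ν² - ν'²|`.
[cite: ReedSimonIV1978, Thm. XIII.64] -/
theorem norm_oblateResolvent_sub_le {N ν ν' : ℝ} (hν : |ν| ≤ N) (hν' : |ν'| ≤ N) :
    ‖oblateResolvent T N ν hν - oblateResolvent T N ν' hν'‖ ≤ 4 * |ν ^ 2 - ν' ^ 2| := by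
  have h := norm_pertResolvent_sub_le (e := sphHarmBasis T) (hr := norm_oblateR₀Coef_le N)
    (norm_oblateR₀_comp_lt hν) (norm_oblateR₀_comp_lt hν')
  refine h.trans ?_
  have h1 := norm_oblateResolvent_le (T := T) hν
  have h2 := norm_oblateResolvent_le (T := T) hν'
  have h3 := norm_oblatePert_sub_le (T := T) ν ν'
  rw [oblateResolvent] at h1 h2
  calc _ ≤ 2 * 2 * |ν ^ 2 - ν' ^ 2| := by
        apply mul_le_mul (mul_le_mul h1 h2 (norm_nonneg _) zero_le_two) h3 (norm_nonneg _)
        positivity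
    _ = 4 * |ν ^ 2 - ν' ^ 2| := by ring

variable (T) in
/-- The resolvent family extended by `0` off `[-N, N]` (a total function of `ν`). [folklore] -/
def oblateResolvent' (N ν : ℝ) : Lp ℂ 2 (sphereMeasure T) →L[ℂ] Lp ℂ 2 (sphereMeasure T) :=
  if h : |ν| ≤ N then oblateResolvent T N ν h else 0

/-- Unfolding on `[-N, N]`. [folklore] -/
theorem oblateResolvent'_of_le {N ν : ℝ} (hν : |ν| ≤ N) :
    oblateResolvent' T N ν = oblateResolvent T N ν hν := by
  rw [oblateResolvent', dif_pos hν]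

/-- **Continuity of `ν ↦ (P(ν) + c_N)⁻¹` on `[-N, N]`** (operator norm).
[cite: ReedSimonIV1978, Thm. XIII.64] -/
theorem continuousOn_oblateResolvent' (N : ℝ) :
    ContinuousOn (oblateResolvent' T N) (Icc (-N) N) := by
  intro ν hν
  have hνa : |ν| ≤ N := abs_le.2 ⟨hν.1, hν.2⟩
  rw [ContinuousWithinAt, Metric.tendsto_nhdsWithin_nhds]
  intro ε hε
  have hN : 0 ≤ N := (abs_nonneg ν).trans hνa
  refine ⟨ε / (8 * N + 1), div_pos hε (by positivity), fun ν' hν' hd ↦ ?_⟩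
  have hνa' : |ν'| ≤ N := abs_le.2 ⟨hν'.1, hν'.2⟩
  rw [dist_eq_norm, oblateResolvent'_of_le hνa', oblateResolvent'_of_le hνa]
  refine (norm_oblateResolvent_sub_le hνa' hνa).trans_lt ?_
  rw [dist_eq_norm, Real.norm_eq_abs] at hd
  have hfac : |ν' ^ 2 - ν ^ 2| ≤ 2 * N * |ν' - ν| := by
    rw [show ν' ^ 2 - ν ^ 2 = (ν' + ν) * (ν' - ν) by ring, abs_mul]
    refine mul_le_mul_of_nonneg_right ?_ (abs_nonneg _)
    calc |ν' + ν| ≤ |ν'| + |ν| := abs_add_le _ _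
      _ ≤ N + N := add_le_add hνa' hνa
      _ = 2 * N := by ring
  calc 4 * |ν' ^ 2 - ν ^ 2| ≤ 4 * (2 * N * |ν' - ν|) := by linarith
    _ = 8 * N * |ν' - ν| := by ring
    _ ≤ (8 * N + 1) * |ν' - ν| := by nlinarith [abs_nonneg (ν' - ν)]
    _ < (8 * N + 1) * (ε / (8 * N + 1)) := by
        exact mul_lt_mul_of_pos_left hd (by positivity)
    _ = ε := by field_simp

end Literature.Analysis.SpecialFunctions
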